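import Literature.NumberTheory.EllipticCurves.IwasawaNakayamaProofs
import Mathlib.Algebra.Module.CharacterModule
import HarnessLib

/-!
# Functoriality of axiomatic Pontryagin duals over `Λ = ℤ_p⟦T⟧`: a `ψ`-equivariant homomorphism `S' → S` induces a
# `Λ`-LINEAR map `X → X'` between dual pairs (`IwasawaDual.IsDualPair`), surjective when `S' ↪ S`, injective when `S' ↠ S`

`Proofs` file (theorems only: no definition, no named fact, no instance, no `sorry`) for the axiomatic duality
`Literature.NumberTheory.EllipticCurves.IwasawaDual.IsDualPair` of `IwasawaNakayamaProofs` (a `Λ`-module `X`, an abelian group `S` with an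
endomorphism `ψ`, `toDual : X ≃ Hom(S, ℚ/ℤ)` with `T` acting as `ψ` and constants through `ℤ_p → ℤ/pᵏ`, `(p, ψ)` locally nilpotent).

WHY (cell `pub/bsd-wall`, width seat `bsd-wall-tp2-p2-w2` g2 on crux K2r0P stmt-BirchSwinnertonDyer-24945; the same gap was recorded by seat
`bsd-wall-utd-p2-w2` g0 on stmt-BirchSwinnertonDyer-23594: «Λ-linear `X^{𝓛'} ↠ X^{𝓛}` — no generic dual-of-inclusion map in tree»). The tree's
Selmer-type Iwasawa modules (`WeierstrassCurve.SelmerDualData`, `Kobayashi2003.SignedSelmerDualData`, `WeierstrassCurve.FineSelmerDualData`, …)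
are ABSTRACT `Λ`-modules pinned to character groups by an `IsDualPair`; an inclusion of Selmer groups (e.g. the tree theorem
`Kobayashi2003.fineSelmerInfty_le_signedSelmerInfty : Sel₀ ≤ Sel^±`) should give a `Λ`-linear SURJECTION of duals `X^± ↠ X₀` (the «definitional
half» of Kobayashi's four-term sequence (7.21); clause (d) of `SignedLowerOffTwo.offTwoLower_of_lowerColemanPackageTwo`). The axioms of a dual
pair pin only the action of `T` and of the constants; that this suffices for `Λ`-linearity of the transported map is the content of this file
(the `𝔪`-adic argument of Lang, *Cyclotomic Fields I–II*, Ch. 5 §1, through the tree's `IsDualPair.smul_mem_annPiece`).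

## What is proved (any prime `p`; dual pairs `(X, S, ψ, toDual)`, `(X', S', ψ', toDual')`; additive `φ : S' → S` with `φ ∘ ψ' = ψ ∘ φ`)

* `IsDualPair.toDual_smul_eq_toDual_trunc_smul` — on the piece `S_n = {pⁿ s = 0, ψⁿ s = 0}` a power series acts through its degree-`< n`
  truncation; `IsDualPair.toDual_monomial_smul` — `toDual ((c Tʲ) • x) s = (c mod pⁿ) • toDual x (ψʲ s)` on `pⁿ`-torsion `s`.
* `IsDualPair.exists_linearMap_comp` — there is a `Λ`-LINEAR `F : X → X'` with `toDual' (F x) s' = toDual x (φ s')`; it is unique among additive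
  maps (`IsDualPair.eq_of_toDual_comp`).
* `IsDualPair.exists_linearMap_comp_surjective` — if `φ` is injective there is such an `F` which is onto (`ℚ/ℤ` is an injective `ℤ`-module:
  Mathlib `CharacterModule.dual_surjective_of_injective`); `IsDualPair.exists_linearMap_comp_injective` — if `φ` is onto, such an `F` is
  injective.

References: [GreenbergLNM1716] §1 p. 60 (the Pontryagin dual as a `Λ`-module); [Lang1990] Ch. 5 §1; Bourbaki, *Algèbre* II §1 no. 9 (duality into an
injective cogenerator is exact).
-/

set_option autoImplicit false

noncomputable section

open scoped Classical

namespace Literature.NumberTheory.EllipticCurves.IwasawaDual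

variable {p : ℕ} [Fact p.Prime]
variable {S : Type*} [AddCommGroup S] {ψ : AddMonoid.End S}
variable {X : Type*} [AddCommGroup X] [Module (PowerSeries ℤ_[p]) X]
variable {toDual : X →+ (S →+ AddCircle (1 : ℚ))}
variable {S' : Type*} [AddCommGroup S'] {ψ' : AddMonoid.End S'}
variable {X' : Type*} [AddCommGroup X'] [Module (PowerSeries ℤ_[p]) X']
variable {toDual' : X' →+ (S' →+ AddCircle (1 : ℚ))}

omit [Fact p.Prime] in
/-- A homomorphism intertwining `ψ'` and `ψ` intertwines their powers. [folklore] -/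
private theorem comp_pow_apply_of_comp_apply (φ : S' →+ S) (hφ : ∀ s', φ (ψ' s') = ψ (φ s')) (j : ℕ) (s' : S') :
    φ ((ψ' ^ j) s') = (ψ ^ j) (φ s') := by
  induction j generalizing s' with
  | zero => simp
  | succ j ih =>
    rw [pow_succ, AddMonoid.End.coe_mul, Function.comp_apply, ih, hφ, pow_succ, AddMonoid.End.coe_mul,
      Function.comp_apply]

omit [Fact p.Prime] in
/-- A homomorphism intertwining `ψ'` and `ψ` maps the pieces `S'_n` into the pieces `S_n`. [folklore] -/
private theorem map_mem_piece (φ : S' →+ S) (hφ : ∀ s', φ (ψ' s') = ψ (φ s')) {n : ℕ} {s' : S'}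
    (hs' : s' ∈ piece p ψ' n) : φ s' ∈ piece p ψ n := by
  rw [mem_piece] at hs' ⊢
  refine ⟨by rw [← map_nsmul, hs'.1, map_zero], ?_⟩
  rw [← comp_pow_apply_of_comp_apply φ hφ, hs'.2, map_zero]

namespace IsDualPair

/-- **A power series acts on a piece through its truncation**: for `s ∈ S_n` (`pⁿ s = 0`, `ψⁿ s = 0`),
`toDual (f • x) s = toDual ((trunc_n f) • x) s` — the difference `(f − trunc_n f) • x` lies in the annihilator `X⁽ⁿ⁾` of `S_n`
(`smul_mem_annPiece`: its coefficients of degree `< n` vanish). [cite: Lang1990, Ch. 5 §1] -/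
theorem toDual_smul_eq_toDual_trunc_smul (h : IsDualPair p ψ toDual) (f : PowerSeries ℤ_[p]) (x : X) {n : ℕ} {s : S}
    (hs : s ∈ piece p ψ n) :
    toDual (f • x) s = toDual (((PowerSeries.trunc n f : Polynomial ℤ_[p]) : PowerSeries ℤ_[p]) • x) s := by
  have hann : (f - ((PowerSeries.trunc n f : Polynomial ℤ_[p]) : PowerSeries ℤ_[p])) • x ∈ annPiece p ψ toDual n :=
    h.smul_mem_annPiece (fun j hj ↦ by
      rw [map_sub, Polynomial.coeff_coe, PowerSeries.coeff_trunc, if_pos hj, sub_self]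
      exact dvd_zero _) x
  have h0 := hann s hs
  rwa [sub_smul, map_sub, AddMonoidHom.sub_apply, sub_eq_zero] at h0

/-- **Evaluation of a monomial**: `toDual ((c·Tʲ : Λ) • x) s = (c mod pⁿ) • toDual x (ψʲ s)` for `pⁿ s = 0` (`C_smul` + iterated `T_smul`).
[cite: GreenbergLNM1716, §1 p. 60 (the Pontryagin dual as a Λ-module)] -/
theorem toDual_monomial_smul (h : IsDualPair p ψ toDual) (j : ℕ) (c : ℤ_[p]) (x : X) {n : ℕ} {s : S}
    (hs : p ^ n • s = 0) :
    toDual (((Polynomial.monomial j c : Polynomial ℤ_[p]) : PowerSeries ℤ_[p]) • x) s =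
      (PadicInt.toZModPow n c).val • toDual x ((ψ ^ j) s) := by
  rw [← Polynomial.C_mul_X_pow_eq_monomial, Polynomial.coe_mul, Polynomial.coe_pow, Polynomial.coe_C,
    Polynomial.coe_X, mul_smul, h.C_smul _ _ s n hs, h.X_pow_smul]

omit [Module (PowerSeries ℤ_[p]) X] in
/-- **Uniqueness**: an additive map `F : X → X'` is determined by the characters `toDual' (F x) = toDual x ∘ φ` (injectivity of `toDual'`).
[cite: GreenbergLNM1716, §1 p. 60 (the Pontryagin dual as a Λ-module)] -/
theorem eq_of_toDual_comp (h' : IsDualPair p ψ' toDual') (φ : S' →+ S) {F G : X →+ X'}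
    (hF : ∀ (x : X) (s' : S'), toDual' (F x) s' = toDual x (φ s'))
    (hG : ∀ (x : X) (s' : S'), toDual' (G x) s' = toDual x (φ s')) : F = G := by
  ext x
  apply h'.bijective.1
  ext s'
  rw [hF, hG]

/-- **Functoriality of dual pairs.** For dual pairs `(X, S, ψ, toDual)` and `(X', S', ψ', toDual')` over `Λ = ℤ_p⟦T⟧` and an additive
`φ : S' → S` with `φ ∘ ψ' = ψ ∘ φ`, there is a `Λ`-LINEAR `F : X → X'` with `toDual' (F x) s' = toDual x (φ s')` for all `x`, `s'` — the
transpose `toDual'⁻¹ ∘ (· ∘ φ) ∘ toDual`. `Λ`-linearity: for `s' ∈ S'_n`, both `toDual' (F (f • x)) s'` and `toDual' (f • F x) s'` are computed by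
the TRUNCATION of `f` (`toDual_smul_eq_toDual_trunc_smul`, as `φ(S'_n) ⊆ S_n`), and on polynomials by `toDual_monomial_smul` and
`φ ∘ ψ'ʲ = ψʲ ∘ φ`; the pieces exhaust `S'` (local nilpotence) and `toDual'` is injective. [cite: GreenbergLNM1716, §1 p. 60]
[cite: Lang1990, Ch. 5 §1] -/
theorem exists_linearMap_comp (h : IsDualPair p ψ toDual) (h' : IsDualPair p ψ' toDual') (φ : S' →+ S)
    (hφ : ∀ s', φ (ψ' s') = ψ (φ s')) :
    ∃ F : X →ₗ[PowerSeries ℤ_[p]] X', ∀ (x : X) (s' : S'), toDual' (F x) s' = toDual x (φ s') := by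
  -- the transpose as an additive map
  let e' : X' ≃+ (S' →+ AddCircle (1 : ℚ)) := AddEquiv.ofBijective toDual' h'.bijective
  let F₀ : X →+ X' :=
    { toFun := fun x ↦ e'.symm ((toDual x).comp φ)
      map_zero' := by
        apply e'.injective
        rw [AddEquiv.apply_symm_apply, map_zero, map_zero, AddMonoidHom.zero_comp]
      map_add' := fun x y ↦ by
        apply e'.injective
        rw [AddEquiv.apply_symm_apply, map_add, map_add, AddEquiv.apply_symm_apply, AddEquiv.apply_symm_apply,
          AddMonoidHom.add_comp] }
  have hF₀ : ∀ (x : X) (s' : S'), toDual' (F₀ x) s' = toDual x (φ s') := fun x s' ↦ by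
    change e' (e'.symm ((toDual x).comp φ)) s' = _
    rw [AddEquiv.apply_symm_apply, AddMonoidHom.comp_apply]
  -- polynomial step: `toDual ((q : Λ) • x) (φ s') = toDual' ((q : Λ) • F₀ x) s'` on `pⁿ`-torsion `s'`
  have hpoly : ∀ (q : Polynomial ℤ_[p]) (x : X) {n : ℕ} (s' : S'), p ^ n • s' = 0 →
      toDual ((q : PowerSeries ℤ_[p]) • x) (φ s') = toDual' ((q : PowerSeries ℤ_[p]) • F₀ x) s' := by
    intro q x n s' hs'
    have hφs' : p ^ n • φ s' = 0 := by rw [← map_nsmul, hs', map_zero]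
    induction q using Polynomial.induction_on' with
    | add q r hq hr =>
      rw [Polynomial.coe_add, add_smul, add_smul, map_add, map_add, AddMonoidHom.add_apply, AddMonoidHom.add_apply,
        hq, hr]
    | monomial j c =>
      rw [h.toDual_monomial_smul j c x hφs', h'.toDual_monomial_smul j c (F₀ x) hs', hF₀,
        comp_pow_apply_of_comp_apply φ hφ]
  -- `Λ`-linearity through the pieces
  have hsmul : ∀ (f : PowerSeries ℤ_[p]) (x : X), F₀ (f • x) = f • F₀ x := by
    intro f x
    rw [← sub_eq_zero]
    refine h'.eq_zero_of_forall_mem_annPiece fun n s' hs' ↦ ?_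
    rw [map_sub, AddMonoidHom.sub_apply, sub_eq_zero, hF₀,
      h.toDual_smul_eq_toDual_trunc_smul f x (map_mem_piece φ hφ hs'),
      h'.toDual_smul_eq_toDual_trunc_smul f (F₀ x) hs', hpoly _ x s' hs'.1]
  exact ⟨{ toFun := F₀, map_add' := F₀.map_add, map_smul' := hsmul }, hF₀⟩

/-- **The transpose of an injection is onto.** If moreover `φ : S' → S` is injective, there is a `Λ`-linear `F : X → X'` with
`toDual' (F x) = toDual x ∘ φ` which is SURJECTIVE: every character of `S'` extends along `φ` to `S` (`ℚ/ℤ` is an injective `ℤ`-module —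
Mathlib `CharacterModule.dual_surjective_of_injective`), and `toDual` is onto. The dual of an inclusion of Selmer groups is a surjection of
Iwasawa modules. [cite: GreenbergLNM1716, §1 p. 60] -/
theorem exists_linearMap_comp_surjective (h : IsDualPair p ψ toDual) (h' : IsDualPair p ψ' toDual') (φ : S' →+ S)
    (hφ : ∀ s', φ (ψ' s') = ψ (φ s')) (hinj : Function.Injective φ) :
    ∃ F : X →ₗ[PowerSeries ℤ_[p]] X', Function.Surjective F ∧
      ∀ (x : X) (s' : S'), toDual' (F x) s' = toDual x (φ s') := by
  obtain ⟨F, hF⟩ := h.exists_linearMap_comp h' φ hφ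
  refine ⟨F, fun x' ↦ ?_, hF⟩
  -- extend the character `toDual' x'` of `S'` along `φ`
  obtain ⟨χ, hχ⟩ := CharacterModule.dual_surjective_of_injective (R := ℤ) φ.toIntLinearMap hinj (toDual' x')
  obtain ⟨x, rfl⟩ := h.bijective.2 χ
  refine ⟨x, h'.bijective.1 ?_⟩
  ext s'
  rw [hF]
  exact congrArg (fun c : CharacterModule S' ↦ c s') hχ

/-- **The transpose of a surjection is injective.** If `φ : S' → S` is onto, every `Λ`-linear (indeed additive) `F : X → X'` with
`toDual' (F x) = toDual x ∘ φ` is injective (`toDual` is injective). [cite: GreenbergLNM1716, §1 p. 60 (the Pontryagin dual as a Λ-module)] -/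
theorem injective_of_toDual_comp (h : IsDualPair p ψ toDual) (φ : S' →+ S) (hsurj : Function.Surjective φ)
    {F : X →ₗ[PowerSeries ℤ_[p]] X'} (hF : ∀ (x : X) (s' : S'), toDual' (F x) s' = toDual x (φ s')) :
    Function.Injective F := by
  rw [← LinearMap.ker_eq_bot, eq_bot_iff]
  intro x hx
  rw [LinearMap.mem_ker] at hx
  rw [Submodule.mem_bot]
  apply h.bijective.1
  rw [map_zero]
  ext s
  obtain ⟨s', rfl⟩ := hsurj s
  rw [← hF, hx, map_zero, AddMonoidHom.zero_apply, AddMonoidHom.zero_apply]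

/-- **The transpose of a surjection, existence form**: if `φ : S' → S` is onto there is an injective `Λ`-linear `F : X → X'` with
`toDual' (F x) = toDual x ∘ φ`. [cite: GreenbergLNM1716, §1 p. 60 (the Pontryagin dual as a Λ-module)] -/
theorem exists_linearMap_comp_injective (h : IsDualPair p ψ toDual) (h' : IsDualPair p ψ' toDual') (φ : S' →+ S)
    (hφ : ∀ s', φ (ψ' s') = ψ (φ s')) (hsurj : Function.Surjective φ) :
    ∃ F : X →ₗ[PowerSeries ℤ_[p]] X', Function.Injective F ∧
      ∀ (x : X) (s' : S'), toDual' (F x) s' = toDual x (φ s') := by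
  obtain ⟨F, hF⟩ := h.exists_linearMap_comp h' φ hφ
  exact ⟨F, h.injective_of_toDual_comp φ hsurj hF, hF⟩

end IsDualPair

end Literature.NumberTheory.EllipticCurves.IwasawaDual

end
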